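import Summits.CriticalPhenomena.PercolationContinuityZ3.Theorems.Transplant.AutProperVirtuallyNilpotent
import HarnessLib

/-!
# Φ2 for COCOMPACT ACTIONS OF ABELIAN AND VIRTUALLY ABELIAN GROUPS WITH STABILISERS OF ANY SIZE — clause (ii) of the lane's C2 words with NO
# stabiliser / freeness / faithfulness / finite-generation hypothesis (kernel, torsion and stabilisers arbitrary)

builds on p205010 (kernel theorem, internal audit signed; external expert review pending).  Lane `prim-bschramm`, seat `prim-bschramm-stmt`
gen 38 (stmt port pen; lead g25 GO #7697, parts (A)(B); parts (C)(D) = the sequel «AutCocompactTorsionFreeNilpotent»).  Helper file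
(`--supports stmt-CriticalPhenomena-4575 --as helper`); PROOFS ONLY (def-free, no `instance`, no notation); NOT by-name — no `@[conjecture]` node is
touched or settled, STATEMENTS §5 counts unchanged; nothing about growth beyond what «AutProperVirtuallyNilpotent» p563737 already carries (Wolf for
the acting nilpotent group, inside that file); nothing about `BenjaminiSchramm1996_conj4_endState`; no 'closed' wording — the words are the lead's.

THE POINT.  gen-5 g3's `AutCyl.conj4_of_nilpotent_of_stabilizers_finite` (p563737) proves `p_c < 1 ⟹ θ_x(p_c) = 0` on every connected locally
finite graph carrying an action by automorphisms of a nilpotent group with finitely many orbits and FINITE vertex stabilisers (no finite-generation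
hypothesis); gen-1 g6's «AutCocompactWolf» p561153 / «AutFreeVirtuallyNilpotent» p562263 need the action FREE; «TranslationInvariantCritical» p565050
is the free regular `ℤ^d` case and the master lemma p588574 needs an injected free `ℤ^e`.  For ABELIAN groups the stabiliser hypothesis is REDUNDANT:

* §1 (the mechanism, [folklore]; the 'bounded automorphisms' / imprimitivity-block circle of ideas of Trofimov 1985 and Woess 2000 §1) — the action
  is ISOMETRIC, so an element `a` FIXING `w` maps the ball `B(w, n)` onto itself (`smul_mem_graphBall_of_smul_eq`, from
  `Literature…smul_mem_graphBall_iff`); hence `{a • v : a • w = w} ⊆ B(w, d(w, v))` is FINITE (`finite_stabilizer_smul`, `graphBall_finite` —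
  this is where 'connected' (a walk `w ⇝ v` exists) and 'locally finite' (balls are finite) enter), and by pigeonhole on `n ↦ s ^ n • v` some power
  `s ^ k`, `k ≥ 1`, of any `s` fixing `w` fixes any given `v` (`exists_pos_pow_smul_eq`: all stabilisers are commensurable).  Also the finite
  section set of a cocompact action (`exists_finset_closure_smul_reps`: `closure S • reps = W`, walk induction as in «AutCocompactGrowth»).
* §2 ABELIAN `A` (`conj4_of_comm_cocompact`, `conj4_of_commGroup_cocompact`): `v = c • r ⟹ a • v = c • (a • r)`, so an element is determined AS A
  PERMUTATION by its values on the finitely many representatives, and `Stab(w) • r` is finite for each `r` (§1) ⟹ the IMAGE of `Stab(w)` in `Perm W`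
  is finite (`finite_toPerm_image_stabilizer`; `Stab(w)` itself may be infinite — it contains the kernel).  PASSAGE TO THE IMAGE (no faithfulness is
  asked): `ι := MulAction.toPermHom A W : A →* Equiv.Perm W`, `A₀ := ι.range ≤ Equiv.Perm W` acting on `W` through Mathlib's `Equiv.Perm` action
  restricted to the subgroup (`σ • v = σ v`); `IsActionByAut X A₀` and 'reps meets every `A₀`-orbit' transfer along `ι a v = a • v`; every
  `A₀`-stabiliser is the injective-coercion preimage of the finite image above; `A₀` is nilpotent as the surjective image (`Group.nilpotent_of_surjective
  ι.rangeRestrict`) of `A`, which is nilpotent of class ≤ 1 (`Z_1 = center = ⊤`, a local `haveI`, no instance declared) — and p563737 applies to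
  `A₀` LITERALLY.  `p_c < 1` stays a HYPOTHESIS (for non-faithful actions 'not virtually cyclic' is not automatic — refuter #7696).
* §3 VIRTUALLY ABELIAN `A` (`conj4_of_virtuallyAbelian_cocompact`): restriction to the finite-index subgroup with commuting elements (gen-1 g6's
  `exists_reps_of_finiteIndex`, `isActionByAut_subgroup`), then §2.
[cite: BenjaminiSchramm1996, §2 (almost transitive graphs), Conj. 4] [cite: Woess2000, Prop. 3.9, Lemma 3.13 (cocompact actions, word lengths)]
[cite: Trofimov1985, Thm. 2 (automorphism groups of graphs: blocks and bounded stabilisers — background for §1 only, not used)]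
[cite: LyonsPeres2016, §7.4 (quasi-transitive actions)]
-/

noncomputable section

namespace Summit.CriticalPhenomena.PercolationContinuityZ3.Theorems.Transplant

namespace AutCyl

open SimpleGraph Literature.Barriers.CriticalPhenomena Literature.Probability.LatticeModels Literature.Probability.Percolation
open scoped Classical

variable {W : Type} {X : SimpleGraph W} {A : Type} [Group A] [MulAction A W]

/-! ## §1 Stabilisers along a connected locally finite graph are commensurable -/

/-- If `a` fixes `v` then so does every power of `a`. [folklore] -/
theorem pow_smul_eq_of_smul_eq {a : A} {v : W} (h : a • v = v) (n : ℕ) : a ^ n • v = v := by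
  induction n with
  | zero => rw [pow_zero, one_smul]
  | succ n ih => rw [pow_succ, mul_smul, h, ih]

/-- **The isometry lemma**: an element acting by automorphisms and FIXING `w` maps the ball `B(w, n)` into itself — `d(w, a • v) = d(a • w, a • v)
= d(w, v)` (`smul_mem_graphBall_iff`: the action is isometric on balls). [folklore] -/
theorem smul_mem_graphBall_of_smul_eq (hact : IsActionByAut X A) {a : A} {w : W} (haw : a • w = w) {v : W} {n : ℕ}
    (hv : v ∈ graphBall X w n) : a • v ∈ graphBall X w n := by
  have h := (smul_mem_graphBall_iff hact a (x := w) (y := v) (n := n)).2 hv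
  rwa [haw] at h

section Commensurable

variable [X.LocallyFinite]

/-- **The stabiliser of `w` moves any vertex `v` inside the finite ball `B(w, d(w,v))`**: the set `{a • v : a • w = w}` is finite — 'connected'
gives a walk `w ⇝ v` of some length `n`, the isometry lemma keeps `a • v` in `B(w, n)`, and 'locally finite' makes `B(w, n)` finite
(`graphBall_finite`). [folklore] [cite: Woess2000, Lemma 3.13] -/
theorem finite_stabilizer_smul (hact : IsActionByAut X A) (hc : X.Connected) (w v : W) :
    {u : W | ∃ a : A, a • w = w ∧ a • v = u}.Finite := by
  obtain ⟨p⟩ := hc w v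
  refine (graphBall_finite X w p.length).subset ?_
  rintro u ⟨a, haw, rfl⟩
  exact smul_mem_graphBall_of_smul_eq hact haw ⟨p, le_rfl⟩

/-- **Commensurability of stabilisers**: if `s` fixes a vertex `w` of a connected locally finite graph on which the group acts by automorphisms,
then for every vertex `v` some power `s ^ k`, `k ≥ 1`, fixes `v` (pigeonhole in the finite set `{a • v : a • w = w}`). [folklore] -/
theorem exists_pos_pow_smul_eq (hact : IsActionByAut X A) (hc : X.Connected) {s : A} {w : W} (hs : s • w = w) (v : W) :
    ∃ k : ℕ, 0 < k ∧ s ^ k • v = v := by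
  have hmem : ∀ n : ℕ, s ^ n • v ∈ {u : W | ∃ a : A, a • w = w ∧ a • v = u} :=
    fun n => ⟨s ^ n, pow_smul_eq_of_smul_eq hs n, rfl⟩
  obtain ⟨a, b, hab, he⟩ := (finite_stabilizer_smul hact hc w v).exists_lt_map_eq_of_forall_mem hmem
  refine ⟨b - a, Nat.sub_pos_of_lt hab, ?_⟩
  have hb : s ^ b = s ^ a * s ^ (b - a) := by rw [← pow_add, Nat.add_sub_cancel' hab.le]
  rw [hb, mul_smul] at he
  exact ((smul_left_cancel_iff (s ^ a)).1 he).symm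

/-- **Finitely many sections carry a cocompact action**: if `reps` meets every orbit, the subgroup generated by the FINITE set of sections of the
neighbours of the representatives already translates `reps` onto every vertex (walk induction from a representative; `X` connected).
[cite: Woess2000, Prop. 3.9 (proof: cocompact actions and word lengths)] -/
theorem exists_finset_closure_smul_reps (hact : IsActionByAut X A) (hc : X.Connected) (reps : Finset W)
    (hcover : ∀ w : W, ∃ a : A, ∃ r ∈ reps, a • r = w) :
    ∃ S : Finset A, ∀ v : W, ∃ a ∈ Subgroup.closure (S : Set A), ∃ r ∈ reps, a • r = v := by
  refine ⟨reps.biUnion fun r => (X.neighborFinset r).image (AutChart.osec hcover), fun v => ?_⟩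
  set S : Finset A := reps.biUnion fun r => (X.neighborFinset r).image (AutChart.osec hcover) with hSdef
  obtain ⟨-, r₀, hr₀, -⟩ := hcover v
  obtain ⟨p⟩ := hc r₀ v
  suffices H : ∀ {u z : W} (q : X.Walk u z), (∃ a ∈ Subgroup.closure (S : Set A), ∃ r ∈ reps, a • r = u) →
      ∃ a ∈ Subgroup.closure (S : Set A), ∃ r ∈ reps, a • r = z from
    H p ⟨1, one_mem _, r₀, hr₀, one_smul A r₀⟩
  intro u z q
  induction q with
  | nil => exact id
  | @cons u u' z h q ih =>
    rintro ⟨a, ha, r, hr, hu⟩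
    apply ih
    have hadj : X.Adj r (a⁻¹ • u') := by
      have h' := (hact a⁻¹ u u').2 h
      rwa [← hu, inv_smul_smul] at h'
    refine ⟨a * AutChart.osec hcover (a⁻¹ • u'), mul_mem ha (Subgroup.subset_closure ?_),
      AutChart.otyp hcover (a⁻¹ • u'), AutChart.otyp_mem hcover _, ?_⟩
    · exact Finset.mem_coe.2 (Finset.mem_biUnion.2 ⟨r, hr, Finset.mem_image.2 ⟨a⁻¹ • u', (X.mem_neighborFinset r _).2 hadj, rfl⟩⟩)
    · rw [mul_smul, AutChart.osec_smul, smul_inv_smul]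

end Commensurable

/-! ## §2 ABELIAN groups: the image of every stabiliser in `Perm W` is finite — NO side condition -/

section Abelian

/-- For a commutative acting group, an element is determined AS A PERMUTATION by its values on a family of orbit representatives
(`v = c • r ⟹ a • v = c • (a • r)`). [folklore] -/
theorem toPerm_eq_of_smul_reps_eq (hcomm : ∀ a b : A, a * b = b * a) {reps : Finset W}
    (hcover : ∀ w : W, ∃ a : A, ∃ r ∈ reps, a • r = w) {a b : A} (h : ∀ r ∈ reps, a • r = b • r) :
    (MulAction.toPerm a : Equiv.Perm W) = MulAction.toPerm b := by
  ext v
  obtain ⟨c, r, hr, rfl⟩ := hcover v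
  simp only [MulAction.toPerm_apply]
  rw [← mul_smul, hcomm a c, mul_smul, h r hr, ← mul_smul, hcomm c b, mul_smul]

variable [X.LocallyFinite]

/-- **ABELIAN ⟹ the image of every stabiliser in `Perm W` is FINITE** (finitely many orbits, connected locally finite graph, action by
automorphisms): `Stab(w) • r` is finite for each of the finitely many representatives `r` (§1) and an element is determined by these values.
The stabiliser itself may be infinite (it contains the kernel of the action). [folklore] -/
theorem finite_toPerm_image_stabilizer (hcomm : ∀ a b : A, a * b = b * a) (hact : IsActionByAut X A) (hc : X.Connected)
    (reps : Finset W) (hcover : ∀ w : W, ∃ a : A, ∃ r ∈ reps, a • r = w) (w : W) :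
    ((fun a : A => (MulAction.toPerm a : Equiv.Perm W)) '' (MulAction.stabilizer A w : Set A)).Finite := by
  let τ : A → (↥reps → W) := fun a r => a • (r : W)
  have hτ : (τ '' (MulAction.stabilizer A w : Set A)).Finite := by
    refine (Set.Finite.pi' (t := fun r : ↥reps => {u : W | ∃ a : A, a • w = w ∧ a • (r : W) = u})
      fun r => finite_stabilizer_smul hact hc w r).subset ?_
    rintro f ⟨a, ha, rfl⟩ r
    exact ⟨a, MulAction.mem_stabilizer_iff.1 ha, rfl⟩
  let Φ : (↥reps → W) → Equiv.Perm W := fun t => if ht : ∃ a : A, τ a = t then MulAction.toPerm ht.choose else 1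
  have hΦ : ∀ a : A, Φ (τ a) = MulAction.toPerm a := fun a => by
    have ht : ∃ a' : A, τ a' = τ a := ⟨a, rfl⟩
    simp only [Φ, dif_pos ht]
    exact toPerm_eq_of_smul_reps_eq hcomm hcover fun r hr => congrFun ht.choose_spec ⟨r, hr⟩
  refine (hτ.image Φ).subset ?_
  rintro σ ⟨a, ha, rfl⟩
  exact ⟨τ a, ⟨a, ha, rfl⟩, hΦ a⟩

/-- **Φ2 / CONJECTURE 4 FOR COCOMPACT ACTIONS OF COMMUTATIVE GROUPS — NO SIDE CONDITION.**  On every connected locally finite graph carrying an action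
by automorphisms of a group `A` whose elements commute, with finitely many orbits (`reps` meets every orbit): `p_c < 1 ⟹ θ_x(p_c) = 0` at every
vertex.  The kernel of the action, the torsion of `A` and the size of the vertex stabilisers are ARBITRARY, and `A` is not assumed finitely generated.
(Pass to the image group `A₀ = A / ker ≤ Perm W`: abelian, same orbits, FINITE stabilisers by `finite_toPerm_image_stabilizer`; then gen-5 g3's
`conj4_of_nilpotent_of_stabilizers_finite`.) [cite: BenjaminiSchramm1996, Conj. 4; §2 (almost transitive graphs)] [cite: LyonsPeres2016, §7.4] -/
theorem conj4_of_comm_cocompact (hcomm : ∀ a b : A, a * b = b * a) (hc : X.Connected) (hact : IsActionByAut X A)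
    (reps : Finset W) (hcover : ∀ w : W, ∃ a : A, ∃ r ∈ reps, a • r = w) (x : W) (hpc : criticalProb X x < 1) :
    theta X x (criticalProbIOf X x) = 0 := by
  set ι : A →* Equiv.Perm W := MulAction.toPermHom A W with hι
  set A₀ : Subgroup (Equiv.Perm W) := ι.range with hA₀
  have hsmul : ∀ (σ : A₀) (v : W), σ • v = (σ : Equiv.Perm W) v := fun _ _ => rfl
  have hιa : ∀ (a : A) (v : W), ι a v = a • v := fun _ _ => rfl
  have hact₀ : IsActionByAut X A₀ := fun σ u v => by
    obtain ⟨a, ha⟩ := MonoidHom.mem_range.1 σ.2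
    rw [hsmul, hsmul, ← ha, hιa, hιa]
    exact hact a u v
  have hcover₀ : ∀ v : W, ∃ σ : A₀, ∃ r ∈ reps, σ • r = v := fun v => by
    obtain ⟨a, r, hr, hv⟩ := hcover v
    exact ⟨⟨ι a, MonoidHom.mem_range.2 ⟨a, rfl⟩⟩, r, hr, by rw [hsmul, Subgroup.coe_mk, hιa, hv]⟩
  have hfin₀ : ∀ v : W, (MulAction.stabilizer A₀ v : Set A₀).Finite := fun v => by
    refine ((finite_toPerm_image_stabilizer hcomm hact hc reps hcover v).preimage Subtype.val_injective.injOn).subset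
      fun σ hσ => ?_
    rw [SetLike.mem_coe, MulAction.mem_stabilizer_iff, hsmul] at hσ
    obtain ⟨a, ha⟩ := MonoidHom.mem_range.1 σ.2
    refine ⟨a, ?_, ha⟩
    rw [SetLike.mem_coe, MulAction.mem_stabilizer_iff, ← hιa, ha]
    exact hσ
  haveI : Group.IsNilpotent A := ⟨⟨1, by
    rw [Subgroup.upperCentralSeries_one]
    exact eq_top_iff.2 fun a _ => Subgroup.mem_center_iff.2 fun b => hcomm b a⟩⟩
  haveI : Group.IsNilpotent A₀ := Group.nilpotent_of_surjective ι.rangeRestrict ι.rangeRestrict_surjective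
  exact conj4_of_nilpotent_of_stabilizers_finite X hc A₀ hact₀ hfin₀ reps hcover₀ x hpc

/-- **Φ2 / CONJECTURE 4 FOR COCOMPACT ACTIONS OF ABELIAN GROUPS — NO SIDE CONDITION** (the `CommGroup` spelling of `conj4_of_comm_cocompact`):
every action by automorphisms of an abelian group with finitely many orbits on a connected locally finite graph with `p_c < 1` has `θ_x(p_c) = 0`
at every vertex `x` — any kernel, any torsion, stabilisers of any size. [cite: BenjaminiSchramm1996, Conj. 4; §2 (almost transitive graphs)] -/
theorem conj4_of_commGroup_cocompact {B : Type} [CommGroup B] [MulAction B W] (hc : X.Connected) (hact : IsActionByAut X B)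
    (reps : Finset W) (hcover : ∀ w : W, ∃ b : B, ∃ r ∈ reps, b • r = w) (x : W) (hpc : criticalProb X x < 1) :
    theta X x (criticalProbIOf X x) = 0 :=
  conj4_of_comm_cocompact (fun a b => mul_comm a b) hc hact reps hcover x hpc

/-! ## §3 VIRTUALLY ABELIAN groups, by restriction -/

/-- **Φ2 / CONJECTURE 4 FOR COCOMPACT ACTIONS OF VIRTUALLY ABELIAN GROUPS — NO stabiliser, freeness, faithfulness or finite-generation hypothesis.**
`A` acts by automorphisms with finitely many orbits on a connected locally finite graph and has a finite-index subgroup `N` whose elements commute: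
`p_c < 1 ⟹ θ_x(p_c) = 0` at every vertex (restrict to `N`: finitely many orbits by `exists_reps_of_finiteIndex`, then §2).
[cite: BenjaminiSchramm1996, Conj. 4; §2 (almost transitive graphs)] [cite: LyonsPeres2016, §7.4 (quasi-transitive actions)] -/
theorem conj4_of_virtuallyAbelian_cocompact (hc : X.Connected) (hact : IsActionByAut X A) (reps : Finset W)
    (hcover : ∀ w : W, ∃ a : A, ∃ r ∈ reps, a • r = w) (N : Subgroup A) [N.FiniteIndex]
    (hN : ∀ a ∈ N, ∀ b ∈ N, a * b = b * a) (x : W) (hpc : criticalProb X x < 1) :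
    theta X x (criticalProbIOf X x) = 0 := by
  obtain ⟨reps', hcover'⟩ := exists_reps_of_finiteIndex N reps hcover
  exact conj4_of_comm_cocompact (A := N) (fun a b => Subtype.ext (hN a a.2 b b.2)) hc (isActionByAut_subgroup hact N)
    reps' hcover' x hpc

end Abelian

end AutCyl

end Summit.CriticalPhenomena.PercolationContinuityZ3.Theorems.Transplant

end
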